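import Summits.AtomisticToContinuum.FouriersLaw.Theorems.LatticeLandauDampingAbelThermodynamicLimitOfUniformAbelianRegularity
import Summits.AtomisticToContinuum.FouriersLaw.Theorems.LatticeLandauDampingAbelThermodynamicLimitSignedTail
import Summits.AtomisticToContinuum.FouriersLaw.Theorems.EmbeddedDrudeMourreAbelOfSpectralDensity
import HarnessLib

/-!
# The ROUTE-FAITHFUL cone of crux `LatticeLandauDamping.AbelThermodynamicLimit` (stmt-AtomisticToContinuum-14013): (R) — or the
signed uniform tail — plus THIS ROUTE'S OWN three spectral cruxes; no seam, no conductance lower bound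
(line `window-regularity` of crux-strategist `planner-cstrat-stmt-AtomisticToContinuum-14013-s2-0`, made importable by the lead of line
`series-law-at-every-laplace-frequency` (SketchIdeator2), rev 17; `--supports` glue file, closes nothing)

Every registered line of this crux and of its `Iff.rfl` twin stmt-12596 closes on (R) = `StaticAbelianSqueeze.UniformAbelianRegularity`
(stmt-AtomisticToContinuum-13416) plus ONE more input whose only job is to make the OUTPUT witness's Abel limit the right positive number: the
seam SI ("WLOG the hypothesis witness is shift-invariant") or CLB = `StaticAbelianSqueeze.ConductanceLowerBound` (stmt-11749).  On route
`LatticeLandauDamping` neither is the honest second input: the route's deciding theorem `closes` feeds the crux the witness it builds from its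
three SPECTRAL cruxes `WindowDecomposition` (stmt-14011) / `NoDrudeWeight` (stmt-14012) / `PositiveDensity` (stmt-14014) and the PROVED
Poisson lemma `AbelOfSpectralDensity` (stmt-12598) — a witness whose DLR state IS shift-invariant.  Hence (strategist s2's
`Lines/window_regularity.lean`, whose sorry-free records are landed here verbatim, proofs unchanged):

* `abelGreenKuboSI_of_window` (registered glue stub `stub_abelGreenKuboSIOfWindow`): the HONEST Abelian Green–Kubo witness
  (shift-invariant DLR state, measure-preserving dynamics, absolutely convergent correlations, `κ > 0`, Abel limit `κ`) from the three
  spectral cruxes — verbatim step 0 of `closes`, keeping the shift-invariance;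
* `witnessShiftInvariant_of_abelGreenKuboSI`: the live line's seam SI (`stub_witnessShiftInvariant`, verbatim) is a corollary;
  `abelGreenKubo_of_abelGreenKuboSI`: the route's filed target `AbelGreenKubo` (stmt-14010) is a corollary;
* `stub_cruxOfRegularityOfWindow` (registered glue stub): **the crux BY NAME from (R) and the three spectral cruxes** — through the
  landed `stub_repairedCruxOfUniformAbelianRegularity` (p127738), the γ-blind hypothesis witness discarded;
* `stub_cruxOfUniformSignedTailOfWindow` (registered glue stub): **the crux BY NAME from the SIGNED UNIFORM TAIL (ST) and the three
  spectral cruxes** — (R) from ST by the landed `stub_uniformAbelianRegularityOfUniformSignedTail` (p148211);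
* `fouriersLaw_of_regularity_of_window`, `fouriersLaw_of_uniformSignedTail_of_window`: the CONJUNCT `FouriersLaw` from the same inputs
  through the route's own `closes` and the landed `NessUnique_holds` / `FiniteResponseOfUnique_holds` — on this route the bridge crux costs
  NOTHING beyond stmt-13416 (or ST).

What is NOT here: (R) / ST themselves (stmt-13416's content, open-problem class) and the three spectral cruxes (this route's engine).
No named fact is used; nothing here closes an item.  References: Bonetto–Lebowitz–Rey-Bellet 2000 §7; Kundu–Dhar–Narayan 2009.
-/

noncomputable section

namespace Summit.AtomisticToContinuum.FouriersLaw.Theorems.AbelThermodynamicLimit.WindowRegularity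

open MeasureTheory Filter Set Topology
open Literature.MathematicalPhysics.KineticTheory.HeatConduction
open Summit.AtomisticToContinuum.FouriersLaw.Theses.LatticeLandauDamping

/-! ## §1 The honest Abelian Green–Kubo witness from the route's three spectral cruxes -/

/-- Lattice-shift invariance in the route's form gives `IsShiftInvariant` (`μ.map shift = μ`). [folklore] -/
theorem isShiftInvariant_of_measurePreserving_shifts {μT : Measure ChainConfig}
    (hshift : ∀ x : ℤ, MeasurePreserving (fun σ : ChainConfig => fun i : ℤ => σ (i + x)) μT μT) :
    IsShiftInvariant μT := by
  show μT.map shift = μT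
  have hfun : (shift : ChainConfig → ChainConfig) = fun σ : ChainConfig => fun i : ℤ => σ (i + 1) := by
    funext σ i
    rfl
  rw [hfun]
  exact (hshift 1).map_eq

/-- **Registered glue stub `stub_abelGreenKuboSIOfWindow` — the HONEST Abelian Green–Kubo witness from the route's three spectral
cruxes** (`WindowDecomposition` stmt-14011, `NoDrudeWeight` stmt-14012, `PositiveDensity` stmt-14014; the Poisson lemma `AbelOfSpectralDensity`
stmt-12598 is PROVED, `latticeLandauDamping_abelOfSpectralDensity_proof`): for `P` (all `> 0`) and every `T > 0` there are a SHIFT-INVARIANT DLR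
Gibbs state `μT`, a `μT`-preserving infinite-volume dynamics with absolutely convergent current correlations and `κ > 0` with
`T⁻² ∫₀^∞ e^{-νt} C_T(t) dt → κ` as `ν ↓ 0`.  Verbatim step 0 of `LatticeLandauDamping.closes`, keeping the shift-invariance
(strategist s2's `abelGreenKuboSI_of_window`, proof unchanged). [cite: KunduDharNarayan2009, eqs. (8)–(15)] -/
theorem stub_abelGreenKuboSIOfWindow :
    Summit.AtomisticToContinuum.FouriersLaw.Theses.LatticeLandauDamping.WindowDecomposition → Summit.AtomisticToContinuum.FouriersLaw.Theses.LatticeLandauDamping.NoDrudeWeight → Summit.AtomisticToContinuum.FouriersLaw.Theses.LatticeLandauDamping.PositiveDensity →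
    ∀ ω₂ lam β γ : ℝ, 0 < ω₂ → 0 < lam → 0 < β → 0 < γ → ∀ T : ℝ, 0 < T →
      ∃ (μT : MeasureTheory.Measure Literature.MathematicalPhysics.KineticTheory.HeatConduction.ChainConfig)
        (D : Literature.MathematicalPhysics.KineticTheory.HeatConduction.InfiniteChainDynamics
          (Literature.MathematicalPhysics.KineticTheory.HeatConduction.pinnedChain ω₂ lam β γ)) (κ : ℝ),
        (Literature.MathematicalPhysics.KineticTheory.HeatConduction.pinnedChain ω₂ lam β γ).IsChainGibbsMeasure T μT ∧
        Literature.MathematicalPhysics.KineticTheory.HeatConduction.IsShiftInvariant μT ∧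
        D.PreservesMeasure μT ∧
        (∀ t : ℝ, D.HasAbsConvergentCorrelation μT t) ∧ 0 < κ ∧
        Filter.Tendsto (fun ν : ℝ => (T ^ 2)⁻¹ *
          MeasureTheory.integral (MeasureTheory.volume.restrict (Set.Ioi (0:ℝ)))
            (fun t : ℝ => Real.exp (-(ν * t)) * (D.currentCorrelation μT) t))
          (nhdsWithin (0:ℝ) (Set.Ioi 0)) (nhds κ) := by
  intro hW hND hPD ω₂ lam β γ hω hl hβ hγ T hT
  obtain ⟨μT, D, hGibbs, hshift, hpres, habs, σ, hfin, hC, δ, g, hδ, hg, hg0, hres⟩ :=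
    hW ω₂ lam β γ hω hl hβ hγ T hT
  have h0 : σ {0} = 0 :=
    hND ω₂ lam β γ hω hl hβ hγ T hT μT D hGibbs hshift hpres habs σ hfin hC
  rw [h0, zero_smul, zero_add] at hres
  have hpos : 0 < g 0 :=
    hPD ω₂ lam β γ hω hl hβ hγ T hT μT D hGibbs hshift hpres habs σ δ g hfin hδ hC hg hg0 hres
  have hlim :=
    Summit.AtomisticToContinuum.FouriersLaw.Theorems.AbelOfSpectralDensity.latticeLandauDamping_abelOfSpectralDensity_proof
      σ (D.currentCorrelation μT) δ g hfin hδ hC hg hg0 hres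
  exact ⟨μT, D, (T ^ 2)⁻¹ * (Real.pi * g 0), hGibbs, isShiftInvariant_of_measurePreserving_shifts hshift, hpres, habs,
    by positivity, hlim.const_mul ((T ^ 2)⁻¹)⟩


/-! ## §2 Corollaries: the live line's seam SI and the route's filed target -/

/-- The live line's seam SI (`stub_witnessShiftInvariant` of `Lines/SketchIdeator2.lean`, verbatim statement) is a COROLLARY of
stub X (ignore SI's hypothesis). [folklore] -/
theorem witnessShiftInvariant_of_abelGreenKuboSI
    (hX : ∀ ω₂ lam β γ : ℝ, 0 < ω₂ → 0 < lam → 0 < β → 0 < γ → ∀ T : ℝ, 0 < T →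
      ∃ (μT : MeasureTheory.Measure Literature.MathematicalPhysics.KineticTheory.HeatConduction.ChainConfig)
        (D : Literature.MathematicalPhysics.KineticTheory.HeatConduction.InfiniteChainDynamics
          (Literature.MathematicalPhysics.KineticTheory.HeatConduction.pinnedChain ω₂ lam β γ)) (κ : ℝ),
        (Literature.MathematicalPhysics.KineticTheory.HeatConduction.pinnedChain ω₂ lam β γ).IsChainGibbsMeasure T μT ∧
        Literature.MathematicalPhysics.KineticTheory.HeatConduction.IsShiftInvariant μT ∧
        D.PreservesMeasure μT ∧
        (∀ t : ℝ, D.HasAbsConvergentCorrelation μT t) ∧ 0 < κ ∧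
        Filter.Tendsto (fun ν : ℝ => (T ^ 2)⁻¹ *
          MeasureTheory.integral (MeasureTheory.volume.restrict (Set.Ioi (0:ℝ)))
            (fun t : ℝ => Real.exp (-(ν * t)) * (D.currentCorrelation μT) t))
          (nhdsWithin (0:ℝ) (Set.Ioi 0)) (nhds κ)) :
    ∀ ω₂ lam β γ : ℝ, 0 < ω₂ → 0 < lam → 0 < β → 0 < γ → ∀ T : ℝ, 0 < T →
      (∃ (μT : MeasureTheory.Measure Literature.MathematicalPhysics.KineticTheory.HeatConduction.ChainConfig)
          (D' : Literature.MathematicalPhysics.KineticTheory.HeatConduction.InfiniteChainDynamics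
            (Literature.MathematicalPhysics.KineticTheory.HeatConduction.pinnedChain ω₂ lam β γ)) (κ : ℝ),
          (Literature.MathematicalPhysics.KineticTheory.HeatConduction.pinnedChain ω₂ lam β γ).IsChainGibbsMeasure T μT ∧
          D'.PreservesMeasure μT ∧ (∀ t : ℝ, D'.HasAbsConvergentCorrelation μT t) ∧ 0 < κ ∧
          Filter.Tendsto (fun ν : ℝ => (T ^ 2)⁻¹ *
            MeasureTheory.integral (MeasureTheory.volume.restrict (Set.Ioi (0:ℝ)))
              (fun t : ℝ => Real.exp (-(ν * t)) * D'.currentCorrelation μT t))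
            (nhdsWithin (0:ℝ) (Set.Ioi 0)) (nhds κ)) →
      ∃ (μT : MeasureTheory.Measure Literature.MathematicalPhysics.KineticTheory.HeatConduction.ChainConfig)
        (D' : Literature.MathematicalPhysics.KineticTheory.HeatConduction.InfiniteChainDynamics
          (Literature.MathematicalPhysics.KineticTheory.HeatConduction.pinnedChain ω₂ lam β γ)) (κ : ℝ),
        (Literature.MathematicalPhysics.KineticTheory.HeatConduction.pinnedChain ω₂ lam β γ).IsChainGibbsMeasure T μT ∧
        Literature.MathematicalPhysics.KineticTheory.HeatConduction.IsShiftInvariant μT ∧ D'.PreservesMeasure μT ∧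
        (∀ t : ℝ, D'.HasAbsConvergentCorrelation μT t) ∧ 0 < κ ∧
        Filter.Tendsto (fun ν : ℝ => (T ^ 2)⁻¹ *
          MeasureTheory.integral (MeasureTheory.volume.restrict (Set.Ioi (0:ℝ)))
            (fun t : ℝ => Real.exp (-(ν * t)) * D'.currentCorrelation μT t))
          (nhdsWithin (0:ℝ) (Set.Ioi 0)) (nhds κ) :=
  fun ω₂ lam β γ hω hl hβ hγ T hT _ => hX ω₂ lam β γ hω hl hβ hγ T hT

/-- Stub X implies the route's filed target `AbelGreenKubo` (stmt-14010) — forget the shift-invariance. [folklore] -/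
theorem abelGreenKubo_of_abelGreenKuboSI
    (hX : ∀ ω₂ lam β γ : ℝ, 0 < ω₂ → 0 < lam → 0 < β → 0 < γ → ∀ T : ℝ, 0 < T →
      ∃ (μT : MeasureTheory.Measure Literature.MathematicalPhysics.KineticTheory.HeatConduction.ChainConfig)
        (D : Literature.MathematicalPhysics.KineticTheory.HeatConduction.InfiniteChainDynamics
          (Literature.MathematicalPhysics.KineticTheory.HeatConduction.pinnedChain ω₂ lam β γ)) (κ : ℝ),
        (Literature.MathematicalPhysics.KineticTheory.HeatConduction.pinnedChain ω₂ lam β γ).IsChainGibbsMeasure T μT ∧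
        Literature.MathematicalPhysics.KineticTheory.HeatConduction.IsShiftInvariant μT ∧
        D.PreservesMeasure μT ∧
        (∀ t : ℝ, D.HasAbsConvergentCorrelation μT t) ∧ 0 < κ ∧
        Filter.Tendsto (fun ν : ℝ => (T ^ 2)⁻¹ *
          MeasureTheory.integral (MeasureTheory.volume.restrict (Set.Ioi (0:ℝ)))
            (fun t : ℝ => Real.exp (-(ν * t)) * (D.currentCorrelation μT) t))
          (nhdsWithin (0:ℝ) (Set.Ioi 0)) (nhds κ)) :
    AbelGreenKubo := by
  intro ω₂ lam β γ hω hl hβ hγ T hT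
  obtain ⟨μT, D, κ, hG, _hS, hP, hAC, hκ, hlim⟩ := hX ω₂ lam β γ hω hl hβ hγ T hT
  exact ⟨μT, D, κ, hG, hP, hAC, hκ, hlim⟩

/-! ## §3 The crux BY NAME over the route-faithful cone, and the conjunct through `closes` -/

/-- **Registered glue stub `stub_cruxOfRegularityOfWindow` — the crux BY NAME from (R) = stmt-13416 and this route's three spectral cruxes**
(strategist s2's `AbelThermodynamicLimit_of_items`): DISCARD the γ-blind hypothesis witness, take the shift-invariant one from
`stub_abelGreenKuboSIOfWindow`, apply the landed `stub_repairedCruxOfUniformAbelianRegularity` (p127738).  No seam, no conductance lower bound.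
[cite: BonettoLebowitzReyBellet2000, §7 eq. (37)] -/
theorem stub_cruxOfRegularityOfWindow :
    Summit.AtomisticToContinuum.FouriersLaw.Theses.StaticAbelianSqueeze.UniformAbelianRegularity → Summit.AtomisticToContinuum.FouriersLaw.Theses.LatticeLandauDamping.WindowDecomposition → Summit.AtomisticToContinuum.FouriersLaw.Theses.LatticeLandauDamping.NoDrudeWeight → Summit.AtomisticToContinuum.FouriersLaw.Theses.LatticeLandauDamping.PositiveDensity →
    Summit.AtomisticToContinuum.FouriersLaw.Theses.LatticeLandauDamping.AbelThermodynamicLimit := by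
  intro hR hW hND hPD ω₂ lam β γ hω hl hβ hγ hU T hT _hex
  exact
    Summit.AtomisticToContinuum.FouriersLaw.Theorems.AbelThermodynamicLimit.SeriesLawAtEveryLaplaceFrequency.stub_repairedCruxOfUniformAbelianRegularity
      hR ω₂ lam β γ hω hl hβ hγ hU T hT (stub_abelGreenKuboSIOfWindow hW hND hPD ω₂ lam β γ hω hl hβ hγ T hT)

/-- **Registered glue stub `stub_cruxOfUniformSignedTailOfWindow` — the crux BY NAME from the SIGNED UNIFORM TAIL and this route's three
spectral cruxes**: (R) from (ST) `∀ ε ∃ τ ∃ N₀ ∀ N ≥ N₀ ∀ t ≥ τ, |∫_{(t,∞)} c_N| ≤ εN` by the landed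
`stub_uniformAbelianRegularityOfUniformSignedTail` (p148211), then `stub_cruxOfRegularityOfWindow` — the route-faithful ONE-RESIDUAL form of the
crux on route `LatticeLandauDamping`. [cite: BonettoLebowitzReyBellet2000, §7 eq. (35)] -/
theorem stub_cruxOfUniformSignedTailOfWindow :
    (∀ ω₂ lam β γ : ℝ, 0 < ω₂ → 0 < lam → 0 < β → 0 < γ → ∀ T : ℝ, 0 < T → ∀ ε : ℝ, 0 < ε → ∃ τ : ℝ, 0 < τ ∧ ∃ N₀ : ℕ, ∀ N : ℕ, N₀ ≤ N → ∀ t : ℝ, τ ≤ t → let J : Literature.MathematicalPhysics.KineticTheory.HeatConduction.PhaseSpace N → ℝ := fun z => ∑ i : Fin N, (Literature.MathematicalPhysics.KineticTheory.HeatConduction.pinnedChain ω₂ lam β γ).bondCurrent N i z; |∫ s in Set.Ioi t, ∫ z, J z * (∫ y, J y ∂((Literature.MathematicalPhysics.KineticTheory.HeatConduction.pinnedChain ω₂ lam β γ).transitionKernel N T T s.toNNReal z)) ∂((Literature.MathematicalPhysics.KineticTheory.HeatConduction.pinnedChain ω₂ lam β γ).gibbsMeasure N T)| ≤ ε * N)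 → Summit.AtomisticToContinuum.FouriersLaw.Theses.LatticeLandauDamping.WindowDecomposition → Summit.AtomisticToContinuum.FouriersLaw.Theses.LatticeLandauDamping.NoDrudeWeight → Summit.AtomisticToContinuum.FouriersLaw.Theses.LatticeLandauDamping.PositiveDensity →
    Summit.AtomisticToContinuum.FouriersLaw.Theses.LatticeLandauDamping.AbelThermodynamicLimit :=
  fun hST hW hND hPD =>
    stub_cruxOfRegularityOfWindow
      (Summit.AtomisticToContinuum.FouriersLaw.Theorems.AbelThermodynamicLimit.SeriesLawAtEveryLaplaceFrequency.stub_uniformAbelianRegularityOfUniformSignedTail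
        hST) hW hND hPD

/-- **Route-level record**: the CONJUNCT `FouriersLaw` from (R) and the three spectral cruxes, through the route's own deciding theorem `closes`
and the landed `NessUnique_holds` / `FiniteResponseOfUnique_holds` (strategist s2's `fouriersLaw_of_items`) — on this route the bridge crux costs
the route NOTHING beyond stmt-13416. [folklore] -/
theorem fouriersLaw_of_regularity_of_window
    (hR : Summit.AtomisticToContinuum.FouriersLaw.Theses.StaticAbelianSqueeze.UniformAbelianRegularity)
    (hW : WindowDecomposition) (hND : NoDrudeWeight) (hPD : PositiveDensity) :
    _root_.FouriersLaw :=
  closes hW hND hPD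
    Summit.AtomisticToContinuum.FouriersLaw.Theorems.AbelOfSpectralDensity.latticeLandauDamping_abelOfSpectralDensity_proof
    (stub_cruxOfRegularityOfWindow hR hW hND hPD) NessUnique_holds FiniteResponseOfUnique_holds

/-- **Route-level record, one-residual form**: the CONJUNCT `FouriersLaw` from the SIGNED UNIFORM TAIL (ST) and the three spectral cruxes.
[folklore] -/
theorem fouriersLaw_of_uniformSignedTail_of_window
    (hST : ∀ ω₂ lam β γ : ℝ, 0 < ω₂ → 0 < lam → 0 < β → 0 < γ → ∀ T : ℝ, 0 < T → ∀ ε : ℝ, 0 < ε → ∃ τ : ℝ, 0 < τ ∧ ∃ N₀ : ℕ, ∀ N : ℕ, N₀ ≤ N → ∀ t : ℝ, τ ≤ t → let J : Literature.MathematicalPhysics.KineticTheory.HeatConduction.PhaseSpace N → ℝ := fun z => ∑ i : Fin N, (Literature.MathematicalPhysics.KineticTheory.HeatConduction.pinnedChain ω₂ lam β γ).bondCurrent N i z; |∫ s in Set.Ioi t, ∫ z, J z * (∫ y, J y ∂((Literature.MathematicalPhysics.KineticTheory.HeatConduction.pinnedChain ω₂ lam β γ).transitionKernel N T T s.toNNReal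 z)) ∂((Literature.MathematicalPhysics.KineticTheory.HeatConduction.pinnedChain ω₂ lam β γ).gibbsMeasure N T)| ≤ ε * N)
    (hW : WindowDecomposition) (hND : NoDrudeWeight) (hPD : PositiveDensity) :
    _root_.FouriersLaw :=
  fouriersLaw_of_regularity_of_window
    (Summit.AtomisticToContinuum.FouriersLaw.Theorems.AbelThermodynamicLimit.SeriesLawAtEveryLaplaceFrequency.stub_uniformAbelianRegularityOfUniformSignedTail
      hST) hW hND hPD

end Summit.AtomisticToContinuum.FouriersLaw.Theorems.AbelThermodynamicLimit.WindowRegularity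

end
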